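import Mathlib
import Summits.ResolutionOfSingularities.ResolutionOfSingularities.Theorems.HomologicalConductorPersistenceSurfaceRationalAssembly
import Summits.ResolutionOfSingularities.ResolutionOfSingularities.Theorems.HomologicalConductorPersistenceFaithfullyFlatDescent
import Summits.ResolutionOfSingularities.ResolutionOfSingularities.Theorems.HomologicalConductorPersistenceSurfaceNormalPartition
import Summits.ResolutionOfSingularities.ResolutionOfSingularities.Theorems.HomologicalConductorPersistenceSurfaceTowerDim
import Literature.RingTheory.CohomologyAnnihilator.TowerRestrict
import Literature.RingTheory.CohomologyAnnihilator.RegularLocalRing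
import HarnessLib

/-!
# Rung S-2 `PersistenceSurface` (stmt-ResolutionOfSingularities-19970) — w44b-o10a:
# the level-four dual cover of ONE STEP from ADD-CLOSURE data, and the regular step

Route `ResolutionOfSingularities/HomologicalConductor`, chain W4.4b (cell res-hironaka; seat res-D-pv-043,
named reserve for o10 by res-L1-w44b-plan-1, 2026-08-27T07:34:07Z). OURS; nothing here is a statement of the
manuscript under review (Hironaka 2017); AI-written, weaker than expert review.

o8 (`…PersistenceSurfaceRationalAssembly`, p507867) typed the interface `HasStepDualCover T T'` of programme
M-rat₄: an étale-local ascent `T → T₁`, a common noetherian algebra `T''` with descent to `T'`, finitely many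
third-syzygy `T₁`-modules `Y j`, and FC-4's cover clause `hcover` — every third syzygy over `T''` is a linear
retract of `T''ᵃ × Π j ((T'' ⊗ Y j)*)^(b j)`. The printed mechanism behind `hcover` at a rational step is
TWO-LAYERED: (IW) the third syzygies over `T''` lie in `add G` for ONE finitely generated module `G` (the sum
of `T''` and the duals of the special Cohen–Macaulay modules; Wunram 1988, Iyama–Wemyss), and (E-sur) `G`
itself lies in `add (T'' ⊕ ⊕ⱼ (T'' ⊗ Y j)*)` (the specials of the new stage are realised by the base-changed
third syzygies of the old one). This file is the VOCABULARY-FREE half of the model (o10a): it turns exactly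
that pair of `add`-closure hypotheses — phrased with the tree's `IsRetractOfPower` ("`X ∈ add G`",
[IyengarTakahashi2014, Def. 4.1]) — into `hcover`, hence into `HasStepDualCover`, and it records the REGULAR
step (`ca⁴(T') = T'`), where the cover is free:

* `exists_retract_prod_pi_of_isRetractOfPower` — unpacking `L ∈ add (R ⊕ ⊕ⱼ D j)` into FC-4's retract shape
  `L ↪ Rᵃ × Πⱼ (D j)^(b j) ↠ L` (linear algebra: `(Fin m → R × Π D) ≃ (Fin m → R) × Πⱼ (Fin m → D j)`);
* `algebraMap_mem_cohomologyAnnihilatorOfDegree_succ_of_stepAddCover` — o8's abstract step at any level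
  `n + 1` with `hcover` replaced by `(hG : G ∈ add (T'' ⊕ ⊕ⱼ (T'' ⊗ Y j)*))` + `(hIW : Ωⁿ(mod T'') ⊆ add G)`;
* `hasStepDualCover_of_addCover` — the same data at level four inhabit `HasStepDualCover T T'`;
* `hasStepDualCover_of_etaleSandwich` — the ring-side conjuncts discharged by the model of record: `T₁` a
  localisation of an étale `T`-algebra (ascent, o5) and `T''` a pointed étale neighbourhood of the local ring
  `T'` (descent, o8b (D3) p509146); what remains of `HasStepDualCover` is the module data `Y`, `G`, (E-sur), (IW);
* `hasStepDualCover_of_cohomologyAnnihilatorOfDegree_four_eq_top` — if `ca⁴(T') = T'` (e.g. `T'` regular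
  local of dimension `≤ 3`, `hasStepDualCover_of_isRegularLocalRing`) then `HasStepDualCover T T'` with
  `T₁ := T`, `T'' := T'` and NO `Y`-modules: `1 ∈ ca⁴(T')` stably annihilates every third syzygy (CA1), i.e.
  third syzygies are retracts of finite free modules. This is the honest-vacuity remark of o8 as a theorem:
  the content of `RationalStepDualCover` / `RationalNormalStepDualCover` sits at the SINGULAR steps;
* `rationalNormalStepDualCover_of_singularSteps` — along the tower (stages noetherian of dimension `≤ 2`),
  o6b's typed premise `RationalNormalStepDualCover` (p509308) follows from its restriction to the steps INTO a
  NON-regular stage: the residual premise that o10 proper discharges from (E-sur) + (IW).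

References: S. B. Iyengar, R. Takahashi, *Annihilation of cohomology and strong generation of module
categories*, IMRN 2016, arXiv:1404.1476 [`IyengarTakahashi2014`].
-/

set_option linter.dupNamespace false

noncomputable section

open CategoryTheory Literature.RingTheory.CohomologyAnnihilator
open Summit.ResolutionOfSingularities.ResolutionOfSingularities.Theorems.NoZeno.SandwichCluster
open Summit.ResolutionOfSingularities.ResolutionOfSingularities.Theorems.HomologicalConductor.PersistenceSurfaceHullCover
open Summit.ResolutionOfSingularities.ResolutionOfSingularities.Theorems.HomologicalConductor.PersistenceSurfaceRationalAssembly
open Summit.ResolutionOfSingularities.ResolutionOfSingularities.Theorems.HomologicalConductor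
open Summit.ResolutionOfSingularities.ResolutionOfSingularities.Theorems.NoZeno.Birth
open Summit.ResolutionOfSingularities.ResolutionOfSingularities.Theorems.HomologicalConductor.PersistenceSurfaceNormalPartition
open Summit.ResolutionOfSingularities.ResolutionOfSingularities.Theorems.HomologicalConductor.PersistenceSurfaceTowerDim
open scoped TensorProduct

namespace Summit.ResolutionOfSingularities.ResolutionOfSingularities.Theorems.HomologicalConductor.PersistenceSurfaceStepAddCover

universe u

/-! ## Unpacking `add (R ⊕ ⊕ⱼ D j)` into FC-4's retract shape -/

/-- **Unpacking an `add`-closure membership.** If `L ∈ add (R ⊕ ⊕ⱼ D j)` (`IsRetractOfPower`, i.e. `L` is a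
retract of `(R × Πⱼ D j)ᵐ`), then `L` is a linear retract of `Rᵃ × Πⱼ (D j)^(b j)` for some `a`, `b` — the
shape of FC-4's `hcover` (p504042) and of o8's `HasStepDualCover`. (Here `a = b j = m`; the regrouping
`(Fin m → R × Πⱼ D j) ≃ₗ (Fin m → R) × Πⱼ (Fin m → D j)` is coordinatewise.)
[cite: IyengarTakahashi2014, Definition 4.1] -/
theorem exists_retract_prod_pi_of_isRetractOfPower {R : Type u} [CommRing R] {ι : Type} [Fintype ι]
    (D : ι → Type u) [∀ j, AddCommGroup (D j)] [∀ j, Module R (D j)] {L : ModuleCat.{u} R}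
    (h : IsRetractOfPower (ModuleCat.of R (R × (Π j, D j))) L) :
    ∃ (a : ℕ) (b : ι → ℕ) (i : L →ₗ[R] ((Fin a → R) × (Π j, Fin (b j) → D j)))
      (r : ((Fin a → R) × (Π j, Fin (b j) → D j)) →ₗ[R] L), r ∘ₗ i = LinearMap.id := by
  obtain ⟨m, i, p, hip⟩ := h
  let ε : (Fin m → (R × (Π j, D j))) ≃ₗ[R] ((Fin m → R) × (Π j, Fin m → D j)) :=
    { toFun := fun f => (fun s => (f s).1, fun j s => (f s).2 j)
      invFun := fun g s => (g.1 s, fun j => g.2 j s)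
      map_add' := fun _ _ => rfl
      map_smul' := fun _ _ => rfl
      left_inv := fun _ => rfl
      right_inv := fun _ => rfl }
  refine ⟨m, fun _ => m, ε.toLinearMap ∘ₗ i.hom, p.hom ∘ₗ ε.symm.toLinearMap, ?_⟩
  refine LinearMap.ext fun x => ?_
  simp only [LinearMap.comp_apply, LinearEquiv.coe_coe, LinearEquiv.symm_apply_apply,
    LinearMap.id_apply]
  exact retract_apply hip x

/-- Conversely, FC-4's retract shape is an `add`-closure membership: a linear retract of
`Rᵃ × Πⱼ (D j)^(b j)` lies in `add (R ⊕ ⊕ⱼ D j)`. [cite: IyengarTakahashi2014, Definition 4.1] -/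
theorem isRetractOfPower_of_retract_prod_pi {R : Type u} [CommRing R] {ι : Type} [Fintype ι]
    (D : ι → Type u) [∀ j, AddCommGroup (D j)] [∀ j, Module R (D j)] {L : ModuleCat.{u} R}
    {a : ℕ} {b : ι → ℕ} (i : L →ₗ[R] ((Fin a → R) × (Π j, Fin (b j) → D j)))
    (r : ((Fin a → R) × (Π j, Fin (b j) → D j)) →ₗ[R] L) (hri : r ∘ₗ i = LinearMap.id) :
    IsRetractOfPower (ModuleCat.of R (R × (Π j, D j))) L := by
  classical
  -- `Rᵃ × Πⱼ (D j)^(b j) ∈ add (R ⊕ ⊕ⱼ D j)`: a product of powers of direct summands of the generator.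
  have hR : IsRetractOfPower (ModuleCat.of R (R × (Π j, D j))) (ModuleCat.of R R) :=
    isRetractOfPower_fst (ModuleCat.of R R) (ModuleCat.of R (Π j, D j))
  have hD : ∀ j, IsRetractOfPower (ModuleCat.of R (R × (Π j, D j))) (ModuleCat.of R (D j)) := fun j =>
    (isRetractOfPower_snd (ModuleCat.of R R) (ModuleCat.of R (Π j, D j))).of_retract
      (ModuleCat.ofHom (LinearMap.single R D j)) (ModuleCat.ofHom (LinearMap.proj j))
      (by apply ModuleCat.hom_ext; exact LinearMap.ext fun x => by simp)
  have hPi : IsRetractOfPower (ModuleCat.of R (R × (Π j, D j))) (ModuleCat.of R (Π j, Fin (b j) → D j)) := by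
    -- induction over the finite index type via `Fintype.induction_empty_option`-free route: use the retract
    -- `Πⱼ (D j)^(b j) ↪ Πⱼ (Π D)^(b j)`? Simpler: `Πⱼ X j` is a retract of `⊕`… we go through `pi` on a `Fin` enumeration.
    obtain ⟨n, ⟨e⟩⟩ : ∃ n, Nonempty (ι ≃ Fin n) := ⟨Fintype.card ι, ⟨Fintype.equivFin ι⟩⟩
    -- reduce to a `Fin n`-indexed product
    suffices h : ∀ (n : ℕ) (X : Fin n → Type u) [∀ s, AddCommGroup (X s)] [∀ s, Module R (X s)],
        (∀ s, IsRetractOfPower (ModuleCat.of R (R × (Π j, D j))) (ModuleCat.of R (X s))) →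
        IsRetractOfPower (ModuleCat.of R (R × (Π j, D j))) (ModuleCat.of R (Π s, X s)) by
      have h' := h n (fun s => Fin (b (e.symm s)) → D (e.symm s)) (fun s => (hD (e.symm s)).pi (b (e.symm s)))
      exact h'.of_iso (LinearEquiv.piCongrLeft R (fun j => Fin (b j) → D j) e.symm).toModuleIso
    intro n
    induction n with
    | zero =>
      intro X _ _ _
      exact isRetractOfPower_of_isZero _ (ModuleCat.isZero_of_subsingleton _)
    | succ n ih =>
      intro X _ _ hX
      have h1 := (hX 0).prod (ih (fun s => X (Fin.succ s)) (fun s => hX (Fin.succ s)))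
      exact h1.of_iso (Fin.consLinearEquiv R X).toModuleIso
  exact ((hR.pi a).prod hPi).of_retract (ModuleCat.ofHom i) (ModuleCat.ofHom r)
    (by apply ModuleCat.hom_ext; exact hri)

/-! ## The step theorem with a two-layer (`add`-closure) cover -/

/-- **The abstract step from `add`-closure data (OURS · w44b-o10a).** Same frame as o8's
`algebraMap_mem_cohomologyAnnihilatorOfDegree_succ_of_stepDualCover` (ascent `T → T₁`, square over `T''`,
descent to `T'`, `n`-th-syzygy `T₁`-modules `Y j`), but the cover clause is supplied in two layers:
(E-sur) a finitely generated `T''`-module `G` with `G ∈ add (T'' ⊕ ⊕ⱼ (T'' ⊗ Y j)*)`, and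
(IW) every `n`-th syzygy of a finitely generated `T''`-module lies in `add G`.
Then `algebraMap T T' x ∈ caⁿ⁺¹(T')` for every `x ∈ caⁿ⁺¹(T)`: `add` is transitive
(`IsRetractOfPower.of_isRetractOfPower_gen`), unpack, apply o8. [cite: IyengarTakahashi2014, Remark 2.13] -/
theorem algebraMap_mem_cohomologyAnnihilatorOfDegree_succ_of_stepAddCover
    {T T' T₁ T'' : Type u} [CommRing T] [CommRing T'] [CommRing T₁] [CommRing T'']
    [Algebra T T'] [Algebra T T₁] [Algebra T₁ T''] [Algebra T' T'']
    [IsNoetherianRing T₁] [IsNoetherianRing T''] (n : ℕ) {x : T}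
    (hx : x ∈ cohomologyAnnihilatorOfDegree T (n + 1))
    (hasc : (cohomologyAnnihilatorOfDegree T (n + 1)).map (algebraMap T T₁) ≤
      cohomologyAnnihilatorOfDegree T₁ (n + 1))
    (hsq : ∀ t : T, algebraMap T₁ T'' (algebraMap T T₁ t) = algebraMap T' T'' (algebraMap T T' t))
    (hdesc : (cohomologyAnnihilatorOfDegree T'' (n + 1)).comap (algebraMap T' T'') ≤
      cohomologyAnnihilatorOfDegree T' (n + 1))
    {ι : Type} [Fintype ι] (Y : ι → ModuleCat.{u} T₁)
    (hY : ∀ j, ∃ M : ModuleCat.{u} T₁, Module.Finite T₁ M ∧ IsSyzygy n M (Y j))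
    (G : ModuleCat.{u} T'')
    (hG : IsRetractOfPower (ModuleCat.of T'' (T'' × (Π j, Module.Dual T'' (T'' ⊗[T₁] Y j)))) G)
    (hIW : ∀ (M L : ModuleCat.{u} T''), Module.Finite T'' M → IsSyzygy n M L → IsRetractOfPower G L) :
    algebraMap T T' x ∈ cohomologyAnnihilatorOfDegree T' (n + 1) := by
  refine algebraMap_mem_cohomologyAnnihilatorOfDegree_succ_of_stepDualCover n hx hasc hsq hdesc Y hY ?_
  intro M L hM hL
  exact exists_retract_prod_pi_of_isRetractOfPower (fun j => Module.Dual T'' (T'' ⊗[T₁] Y j))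
    (hG.of_isRetractOfPower_gen (hIW M L hM hL))

/-- **`HasStepDualCover` from `add`-closure data (OURS · w44b-o10a).** The level-four instance: a noetherian
`T`-algebra `T₁` with ascent `ca⁴(T) T₁ ⊆ ca⁴(T₁)`, a noetherian common `T₁`- and `T'`-algebra `T''` (square on `T`)
with descent `ca⁴(T'') ∩ T' ⊆ ca⁴(T')`, third-syzygy `T₁`-modules `Y j`, a `T''`-module `G` in
`add (T'' ⊕ ⊕ⱼ (T'' ⊗ Y j)*)` (E-sur) generating all third syzygies over `T''` up to `add` (IW)
⊢ `HasStepDualCover T T'`. [cite: IyengarTakahashi2014, Definition 4.1] -/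
theorem hasStepDualCover_of_addCover
    {T T' : Type} [CommRing T] [CommRing T'] [Algebra T T']
    (T₁ : Type) [CommRing T₁] [Algebra T T₁] [IsNoetherianRing T₁]
    (T'' : Type) [CommRing T''] [Algebra T₁ T''] [Algebra T' T''] [IsNoetherianRing T'']
    (hasc : (cohomologyAnnihilatorOfDegree T 4).map (algebraMap T T₁) ≤ cohomologyAnnihilatorOfDegree T₁ 4)
    (hsq : ∀ t : T, algebraMap T₁ T'' (algebraMap T T₁ t) = algebraMap T' T'' (algebraMap T T' t))
    (hdesc : (cohomologyAnnihilatorOfDegree T'' 4).comap (algebraMap T' T'') ≤ cohomologyAnnihilatorOfDegree T' 4)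
    {ι : Type} [Fintype ι] (Y : ι → ModuleCat.{0} T₁)
    (hY : ∀ j, ∃ M : ModuleCat.{0} T₁, Module.Finite T₁ M ∧ IsSyzygy 3 M (Y j))
    (G : ModuleCat.{0} T'')
    (hG : IsRetractOfPower (ModuleCat.of T'' (T'' × (Π j, Module.Dual T'' (T'' ⊗[T₁] Y j)))) G)
    (hIW : ∀ (M L : ModuleCat.{0} T''), Module.Finite T'' M → IsSyzygy 3 M L → IsRetractOfPower G L) :
    HasStepDualCover T T' :=
  ⟨T₁, inferInstance, inferInstance, inferInstance, T'', inferInstance, inferInstance, inferInstance,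
    inferInstance, hasc, hsq, hdesc, ι, inferInstance, Y, hY, fun M L hM hL =>
      exists_retract_prod_pi_of_isRetractOfPower (fun j => Module.Dual T'' (T'' ⊗[T₁] Y j))
        (hG.of_isRetractOfPower_gen (hIW M L hM hL))⟩

/-! ## The étale sandwich: ascent (o5) and descent (o8b) discharged -/

/-- **`HasStepDualCover` over an ÉTALE SANDWICH (OURS · w44b-o10a).** The model of record for the two ring-side
conjuncts: `T₁` a localisation of an étale `T`-algebra `E` (ascent `ca⁴(T) T₁ ⊆ ca⁴(T₁)` by o5,
`hasc_of_etaleNeighbourhood`, p504897/p507867) and `T''` a POINTED étale neighbourhood `E'_𝔮` of the noetherian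
local ring `T'` (descent `ca⁴(T'') ∩ T' ⊆ ca⁴(T')` by o8b (D3),
`comap_cohomologyAnnihilatorOfDegree_succ_le_of_etale_neighbourhood`, p509146), with a `T₁`-algebra structure on
`T''` making the square commute on `T`. Over such a sandwich, `HasStepDualCover T T'` reduces to the module
data alone: third-syzygy `T₁`-modules `Y j`, and a `T''`-module `G ∈ add (T'' ⊕ ⊕ⱼ (T'' ⊗ Y j)*)` (E-sur) with
`Ω³(mod T'') ⊆ add G` (IW). [cite: IyengarTakahashi2014, Definition 4.1] -/
theorem hasStepDualCover_of_etaleSandwich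
    {T T' : Type} [CommRing T] [CommRing T'] [Algebra T T'] [IsNoetherianRing T] [IsNoetherianRing T']
    [IsLocalRing T']
    (E T₁ : Type) [CommRing E] [CommRing T₁] [Algebra T E] [Algebra E T₁] [Algebra T T₁]
    [IsScalarTower T E T₁] [Algebra.Etale T E] (U : Submonoid E) [IsLocalization U T₁]
    (E' T'' : Type) [CommRing E'] [CommRing T''] [Algebra T' E'] [Algebra E' T''] [Algebra T' T'']
    [IsScalarTower T' E' T''] [Algebra.Etale T' E'] (𝔮 : Ideal E') [𝔮.IsPrime]
    [IsLocalization.AtPrime T'' 𝔮] (h𝔮 : 𝔮.under T' = IsLocalRing.maximalIdeal T')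
    [Algebra T₁ T'']
    (hsq : ∀ t : T, algebraMap T₁ T'' (algebraMap T T₁ t) = algebraMap T' T'' (algebraMap T T' t))
    {ι : Type} [Fintype ι] (Y : ι → ModuleCat.{0} T₁)
    (hY : ∀ j, ∃ M : ModuleCat.{0} T₁, Module.Finite T₁ M ∧ IsSyzygy 3 M (Y j))
    (G : ModuleCat.{0} T'')
    (hG : IsRetractOfPower (ModuleCat.of T'' (T'' × (Π j, Module.Dual T'' (T'' ⊗[T₁] Y j)))) G)
    (hIW : ∀ (M L : ModuleCat.{0} T''), Module.Finite T'' M → IsSyzygy 3 M L → IsRetractOfPower G L) :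
    HasStepDualCover T T' := by
  haveI : IsNoetherianRing E := Algebra.FiniteType.isNoetherianRing T E
  haveI : IsNoetherianRing T₁ := IsLocalization.isNoetherianRing U T₁ inferInstance
  haveI : IsNoetherianRing E' := Algebra.FiniteType.isNoetherianRing T' E'
  haveI : IsNoetherianRing T'' := IsLocalization.isNoetherianRing 𝔮.primeCompl T'' inferInstance
  exact hasStepDualCover_of_addCover T₁ T'' (hasc_of_etaleNeighbourhood (T := T) (S := E) (T₁ := T₁) U) hsq
    (PersistenceFaithfullyFlatDescent.comap_cohomologyAnnihilatorOfDegree_succ_le_of_etale_neighbourhood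
      (T := T') (E := E') (S := T'') 𝔮 h𝔮 3) Y hY G hG hIW

/-! ## The regular step: `ca⁴(T') = T'` -/

/-- **Third syzygies are free retracts when `caⁿ⁺¹ = ⊤`.** Over a noetherian ring `R` with `caⁿ⁺¹(R) = R`,
every `n`-th syzygy `L` of a finitely generated module is a linear retract of a finite free module: `1`
stably annihilates `L` (CA1, `mem_cohomologyAnnihilatorOfDegree_succ_iff_forall_isSyzygy`), and a free
factorisation of `1 • 𝟙 L` is a retraction. [cite: IyengarTakahashi2014, Remark 2.13] -/
theorem exists_retract_free_of_cohomologyAnnihilatorOfDegree_succ_eq_top {R : Type u} [CommRing R]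
    [IsNoetherianRing R] {n : ℕ} (h : cohomologyAnnihilatorOfDegree R (n + 1) = ⊤)
    {M L : ModuleCat.{u} R} (hM : Module.Finite R M) (hL : IsSyzygy n M L) :
    ∃ (s : ℕ) (i : L →ₗ[R] (Fin s → R)) (r : (Fin s → R) →ₗ[R] L), r ∘ₗ i = LinearMap.id := by
  have h1 : (1 : R) ∈ cohomologyAnnihilatorOfDegree R (n + 1) := h ▸ Submodule.mem_top
  have h2 : StablyAnnihilates R 1 L :=
    (mem_cohomologyAnnihilatorOfDegree_succ_iff_forall_isSyzygy (1 : R)).mp h1 M L hM hL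
  obtain ⟨s, i, r, hri⟩ := (stablyAnnihilates_iff_exists_linearMap (1 : R) L).mp h2
  exact ⟨s, i, r, by rw [hri, one_smul]⟩

/-- **The regular step (OURS · w44b-o10a).** If `T` and `T'` are noetherian and `ca⁴(T') = T'`, then
`HasStepDualCover T T'` — with `T₁ := T`, `T'' := T'`, no `Y`-modules, and the free cover of
`exists_retract_free_of_cohomologyAnnihilatorOfDegree_succ_eq_top`. The honest-vacuity remark of o8
(p507867) as a theorem: along a tower the typed premise `Rational(Normal)StepDualCover` has content only at
the steps INTO a singular stage. [cite: IyengarTakahashi2014, Example 2.5] -/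
theorem hasStepDualCover_of_cohomologyAnnihilatorOfDegree_four_eq_top
    {T T' : Type} [CommRing T] [CommRing T'] [Algebra T T'] [IsNoetherianRing T] [IsNoetherianRing T']
    (h : cohomologyAnnihilatorOfDegree T' 4 = ⊤) : HasStepDualCover T T' := by
  refine ⟨T, inferInstance, inferInstance, inferInstance, T', inferInstance, inferInstance,
    inferInstance, inferInstance, ?_, ?_, ?_, Fin 0, inferInstance, fun j => j.elim0, fun j => j.elim0, ?_⟩
  · rw [Algebra.algebraMap_self, Ideal.map_id]
  · intro t
    simp only [Algebra.algebraMap_self, RingHom.id_apply]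
  · rw [Algebra.algebraMap_self, Ideal.comap_id]
  · intro M L hM hL
    obtain ⟨s, i, r, hri⟩ := exists_retract_free_of_cohomologyAnnihilatorOfDegree_succ_eq_top h hM hL
    refine ⟨s, fun _ => 0, (LinearMap.inl T' _ _) ∘ₗ i, r ∘ₗ LinearMap.fst T' _ _, ?_⟩
    rw [LinearMap.comp_assoc, ← LinearMap.comp_assoc i, LinearMap.fst_comp_inl, LinearMap.id_comp, hri]

/-- **The regular step, local form.** If `T'` is a regular local ring of dimension `d ≤ 3` (and `T` is
noetherian) then `HasStepDualCover T T'`: `caᵈ⁺¹(T') = T'` (Serre; `cohomologyAnnihilatorOfDegree_eq_top_of_isRegularLocalRing`)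
and `caᵈ⁺¹ ⊆ ca⁴`. Surface-tower stages have `d ≤ 2`. [cite: IyengarTakahashi2014, Example 2.5] -/
theorem hasStepDualCover_of_isRegularLocalRing
    {T T' : Type} [CommRing T] [CommRing T'] [Algebra T T'] [IsNoetherianRing T] [IsRegularLocalRing T']
    {d : ℕ} (hd : ringKrullDim T' = d) (hd3 : d ≤ 3) : HasStepDualCover T T' := by
  haveI : IsNoetherianRing T' := inferInstance
  refine hasStepDualCover_of_cohomologyAnnihilatorOfDegree_four_eq_top (eq_top_iff.mpr ?_)
  rw [← cohomologyAnnihilatorOfDegree_eq_top_of_isRegularLocalRing T' hd]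
  exact cohomologyAnnihilatorOfDegree_mono (by omega)

/-- **The regular step, `≤` form.** If `T'` is a regular local ring with `ringKrullDim T' ≤ 3` (and `T` is
noetherian) then `HasStepDualCover T T'` (a noetherian local ring has dimension a natural number).
[cite: IyengarTakahashi2014, Example 2.5] -/
theorem hasStepDualCover_of_isRegularLocalRing_of_le
    {T T' : Type} [CommRing T] [CommRing T'] [Algebra T T'] [IsNoetherianRing T] [IsRegularLocalRing T']
    (h3 : ringKrullDim T' ≤ (3 : ℕ)) : HasStepDualCover T T' := by
  obtain ⟨d, hd⟩ := Literature.AlgebraicGeometry.Resolution.ringKrullDim_eq_nat (R := T')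
  have hd3 : d ≤ 3 := by
    rw [hd] at h3
    exact_mod_cast h3
  exact hasStepDualCover_of_isRegularLocalRing hd hd3

/-! ## Along the tower: `RationalNormalStepDualCover` from its SINGULAR steps -/

/-- **`RationalNormalStepDualCover` reduces to the steps INTO a singular stage (OURS · w44b-o10a).** Along the
canonical normalised `ca`-tower of a surface datum (binders verbatim those of o6b's `RationalNormalStepDualCover`,
p509308) every stage is a noetherian ring of Krull dimension `≤ 2` (`stub_towerNoetherian`,
`ringKrullDim_tower_le_of_ringKrullDim_le`), so at a step `T_m → T_(m+1)` with `T_(m+1)` REGULAR local the dual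
cover is free (`hasStepDualCover_of_isRegularLocalRing_of_le`). Hence the typed premise follows from its
restriction to the steps whose target stage is NOT regular — the residual premise o10 proper discharges from
(E-sur) + (IW). [folklore] -/
theorem rationalNormalStepDualCover_of_singularSteps
    (h : ∀ p : ℕ, p.Prime → ∀ (k K : Type) [Field k] [CharP k p] [Field K] [Algebra k K]
      (O : ValuationSubring K) (A : Subalgebra k K), (∀ c : k, algebraMap k K c ∈ O) → A.FG →
      IsFractionRing ↥A K → A.toSubring ≤ O.toSubring → ringKrullDim ↥A ≤ 2 →
      ((IsIntegrallyClosed ↥(tower O A 0) ∧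
        Literature.AlgebraicGeometry.Resolution.HasRationalSingularity ↥(tower O A 0)) ∨
        IsRegularLocalRing ↥(tower O A 0)) →
      ∀ (m : ℕ) (hle : tower O A m ≤ tower O A (m + 1)), ¬ IsRegularLocalRing ↥(tower O A (m + 1)) →
        letI := (Subalgebra.inclusion hle).toRingHom.toAlgebra
        HasStepDualCover ↥(tower O A m) ↥(tower O A (m + 1))) :
    RationalNormalStepDualCover := by
  intro p hp k K _ _ _ _ O A hk hA hfr hAO hdim hRN m hle
  letI := (Subalgebra.inclusion hle).toRingHom.toAlgebra
  by_cases hreg : IsRegularLocalRing ↥(tower O A (m + 1))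
  · haveI : IsNoetherianRing ↥(tower O A m) := stub_towerNoetherian k K O A hk hA hfr hAO m
    haveI : IsFractionRing ↥A K := hfr
    have hd2 : ringKrullDim ↥(tower O A (m + 1)) ≤ (2 : ℕ) :=
      ringKrullDim_tower_le_of_ringKrullDim_le O A hA (by exact_mod_cast hdim) (m + 1)
    exact hasStepDualCover_of_isRegularLocalRing_of_le (hd2.trans (by exact_mod_cast (by norm_num : (2 : ℕ) ≤ 3)))
  · exact h p hp k K O A hk hA hfr hAO hdim hRN m hle hreg

end Summit.ResolutionOfSingularities.ResolutionOfSingularities.Theorems.HomologicalConductor.PersistenceSurfaceStepAddCover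

end
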